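import Mathlib.Algebra.Polynomial.FieldDivision
import Mathlib.RingTheory.Polynomial.Basic
import Mathlib.LinearAlgebra.Dimension.Constructions
import Mathlib.Data.Nat.Size
import Mathlib.Order.ConditionallyCompleteLattice.Basic
import Literature.Algebra.EuclideanDomain.MotzkinConstruction
import HarnessLib

/-!
# The smallest algorithm: infima of algorithms, `ℤ` (binary digits) and `k[X]` (the degree) — Samuel 1971, §§3–4

Topic `Literature/Algebra/EuclideanDomain`, namespace `Literature.Algebra.EuclideanDomain` (continuing
`MotzkinConstruction.lean`: `motzkinSet k = P₀^{(k)}`, `motzkinRank`, `motzkinNorm`).  THEOREMS ONLY (no `def`,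
no instance, no named fact); everything PROVED.

## Source (read at the page)

P. Samuel, *About Euclidean rings*, J. Algebra **19** (1971) 282–301 [Samuel1971] (materialised
`paper:doi-10-1016-0021-8693-71-90110-4`, pp. 282, 285, 288–290), VERBATIM:
* Definition 1 (p. 282): «a Euclidean algorithm (or an algorithm) in `A` is a map `φ` of `A` into a well-ordered
  set `W` such that (E): given `a, b ∈ A`, `b ≠ 0`, there exist `q` and `r` in `A` such that `a = bq + r` and
  `φ(r) < φ(b)`.»
* §3 (p. 285): «It is well known that `ℤ` is Euclidean for the algorithm `φ(n) = |n|`, and that the polynomial ring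
  `k[X]` (`k`: a field) is Euclidean for `φ(P(X)) = 1 + d°(P(X))`.»
* Proposition 9 (p. 288): «If `φ_α : A → W` is any nonempty family of algorithms on an Euclidean ring `A`, then
  `φ = inf_α φ_α` is also an algorithm.» — «Proposition 9 shows that the Euclidean ring `A` admits a smallest
  algorithm `θ` (i.e. the infimum of all algorithms).»
* The transfinite construction (p. 289): «`A₀ = {0}` … `A_α` is the union of `{0}` and of the set of all `b ∈ A`
  such that `A'_α → A/Ab` is surjective» (`A'_α = ⋃_{β<α} A_β`), «the smallest algorithm `θ` on `A` is defined by
  `θ(x) = α ⟺ x ∈ A_α − A'_α`» (4.3); «`A₁ − A₀` = set of units `A*`» (4.5).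
* Example (1) (p. 289): «For `A = ℤ`, we have `A'₁ = A₁ = {−1, 0, +1}` … `A'₂ = A₂ = {−3, …, 3}` … `A'₃ = A₃` is
  the interval `[−7, +7]` … An easy induction shows that the smallest algorithm `θ` on `ℤ` is given by
  `θ(n) =` number of binary digits of `|n|`.»
* Example (2) (p. 290): «Let `K` be a field, and `A` the polynomial ring in one variable `A = k[X]`.  Since
  `A* = k*` we have `A'₁ = A₁ = k`. … By induction we see that `A'_{n+1} = A_n` is the `n`-dimensional vector space
  of polynomials with degree `≤ n − 1`.  Therefore the smallest algorithm `θ` on `k[X]` is the usual algorithm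
  `θ(φ) = 1 + d°(φ)` (`φ ≠ 0`).»

## Dictionary

Samuel's `A_n` (finite stages of the transfinite construction) is the complement of Motzkin's `P₀^{(n)}`:
`A₀ = {0} = (P₀)ᶜ`, and `b ∈ A_{n+1} ⟺ b = 0 ∨ (A_n ↠ A/Ab) ⟺ b ∉ (P₀^{(n)})′ = P₀^{(n+1)}`
(`mem_motzkinDerived`); hence Samuel's smallest algorithm `θ` (with `θ(0) = 0`, `θ(unit) = 1`) is the tree's
`motzkinRank` («Motzkin's fastest norm shifted by one») and Motzkin's norm is `motzkinNorm = θ − 1`.  We work, as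
`MotzkinConstruction.lean` does, with `ℕ`-valued algorithms in form (iii) `a = bq + s`, `s = 0 ∨ φ s < φ b`
(for these the value at `0` is irrelevant); Samuel's transfinite-valued generality is not needed for `ℤ` and
`k[X]`, whose smallest algorithms are finite-valued.

## Main statements

* `euclideanFunction_iInf` (Proposition 9 for `ℕ`-valued algorithms), `iInf_euclideanFunction_eq_motzkinNorm`
  («the smallest algorithm is the infimum of all algorithms»: `⨅_φ φ(b) = motzkinNorm b`).
* `Int.motzkinRank_eq_size` (Example (1): `θ(n)` = number of binary digits of `|n|`), `Int.not_mem_motzkinSet_iff`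
  (`A_k = [−(2^k − 1), 2^k − 1]`), `Int.samuel_stages` (`A₁ = [−1,1]`, `A₂ = [−3,3]`, `A₃ = [−7,7]`).
* `Polynomial.natDegree_euclidean` (§3: `k[X]` is Euclidean for the degree), **`Polynomial.motzkinSet_eq`**
  (`P₀^{(n)} = {f ≠ 0 : d°f ≥ n}`), `Polynomial.compl_motzkinSet_eq_degreeLT` / `Polynomial.finrank_degreeLT`
  (`A_n` is the `n`-dimensional space of polynomials of degree `≤ n − 1`), `Polynomial.forall_exists_not_mem_motzkinSet`
  (Motzkin's criterion holds), **`Polynomial.motzkinRank_eq`** (`θ(φ) = 1 + d°(φ)`),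
  **`Polynomial.motzkinNorm_eq_natDegree`**, `Polynomial.natDegree_le_of_euclideanFunction` (the degree is the
  smallest `ℕ`-valued algorithm on `k[X]`).

## Mathlib / tree search

Mathlib: `Polynomial` over a field is a `EuclideanDomain` for the degree (`EuclideanDomain.mod_lt : degree (p % q)
< degree q`, `EuclideanDomain.div_add_mod`), `Polynomial.degreeLT` / `degreeLTEquiv` (polynomials of degree `< n`
as an `n`-dimensional space), `Nat.size` (number of binary digits, `Nat.size_le`, `Nat.lt_size_self`), `Nat.sInf_mem`;
no statement that the degree is the *smallest* Euclidean function (`lean search 'motzkin|smallest algorithm'`: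
tree only).  Tree: `MotzkinConstruction.lean` (`Int.motzkinSet_eq`, `Int.motzkinNorm_eq_log`, `motzkinNorm_le`,
`exists_remainder_motzkinNorm`), `MinimalEuclideanFunctionSuperadditive.lean` (Samuel's Prop. 12 = Lenstra's
superadditivity, already proved there).
-/

namespace Literature.Algebra.EuclideanDomain

open Polynomial

/-! ## §1 Proposition 9: infima of algorithms; the smallest algorithm as an infimum -/

section Inf

variable {R : Type*} [CommRing R]

/-- **Proposition 9** (for `ℕ`-valued algorithms in form (iii)): «If `φ_α` is any nonempty family of algorithms
on a Euclidean ring `A`, then `φ = inf_α φ_α` is also an algorithm» — for `b ≠ 0` pick `α` with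
`φ(b) = φ_α(b)` and divide by `φ_α`. [cite: Samuel1971, Prop. 9 (p. 288)] -/
theorem euclideanFunction_iInf {ι : Type*} [Nonempty ι] {φ : ι → R → ℕ}
    (hφ : ∀ i, ∀ a b : R, b ≠ 0 → ∃ q s : R, a = b * q + s ∧ (s = 0 ∨ φ i s < φ i b)) :
    ∀ a b : R, b ≠ 0 → ∃ q s : R, a = b * q + s ∧ (s = 0 ∨ (⨅ i, φ i s) < ⨅ i, φ i b) := by
  intro a b hb
  obtain ⟨i, hi⟩ : ∃ i, (⨅ j, φ j b) = φ i b := by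
    obtain ⟨i, hi⟩ := Nat.sInf_mem (Set.range_nonempty (fun j ↦ φ j b))
    exact ⟨i, hi.symm⟩
  obtain ⟨q, s, h, hs⟩ := hφ i a b hb
  refine ⟨q, s, h, hs.imp_right fun hlt ↦ ?_⟩
  rw [hi]
  exact (ciInf_le (OrderBot.bddBelow _) i).trans_lt hlt

/-- «Proposition 9 shows that the Euclidean ring `A` admits a smallest algorithm `θ` (i.e. the infimum of all
algorithms)»: under Motzkin's criterion `h`, the pointwise infimum over ALL `ℕ`-valued algorithms (form (iii))
is Motzkin's norm `motzkinNorm h` (itself an algorithm, `exists_remainder_motzkinNorm`, and below every other one,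
`motzkinNorm_le`). [cite: Samuel1971, Prop. 9 (p. 288)] -/
theorem iInf_euclideanFunction_eq_motzkinNorm (h : ∀ b : R, ∃ k : ℕ, b ∉ motzkinSet k) (b : R) :
    (⨅ φ : {φ : R → ℕ // ∀ a b : R, b ≠ 0 → ∃ q s : R, a = b * q + s ∧ (s = 0 ∨ φ s < φ b)}, (φ : R → ℕ) b) =
      motzkinNorm h b := by
  have hne : Nonempty {φ : R → ℕ // ∀ a b : R, b ≠ 0 → ∃ q s : R, a = b * q + s ∧ (s = 0 ∨ φ s < φ b)} :=
    ⟨⟨motzkinNorm h, fun a b hb ↦ exists_remainder_motzkinNorm h a b hb⟩⟩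
  apply le_antisymm
  · let φ₀ : {φ : R → ℕ // ∀ a b : R, b ≠ 0 → ∃ q s : R, a = b * q + s ∧ (s = 0 ∨ φ s < φ b)} :=
      ⟨motzkinNorm h, fun a b hb ↦ exists_remainder_motzkinNorm h a b hb⟩
    exact ciInf_le (OrderBot.bddBelow _) φ₀
  · refine le_ciInf fun φ ↦ ?_
    by_cases hb : b = 0
    · subst hb
      have : motzkinNorm h (0 : R) = 0 := by
        unfold motzkinNorm; rw [(motzkinRank_eq_zero_iff h).mpr rfl]
      rw [this]; exact Nat.zero_le _
    · exact motzkinNorm_le h φ.2 hb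

end Inf

/-! ## §2 Example (1): the rational integers — `θ(n)` is the number of binary digits of `|n|` -/

/-- Samuel's stages for `ℤ`: `n ∈ A_k ⟺ n ∉ P₀^{(k)} ⟺ |n| < 2^k`, i.e. `A_k = [−(2^k − 1), 2^k − 1]`
(`2^{k+1} − 1` consecutive integers). [cite: Samuel1971, §4 Example (1) (p. 289)] -/
theorem Int.not_mem_motzkinSet_iff (k : ℕ) (n : ℤ) : n ∉ (motzkinSet k : Set ℤ) ↔ n.natAbs < 2 ^ k := by
  rw [Int.motzkinSet_eq]; simp

/-- «For `A = ℤ`, we have `A'₁ = A₁ = {−1, 0, +1}` … `A'₂ = A₂ = {−3, −2, −1, 0, 1, 2, 3}` … `A'₃ = A₃` is the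
interval `[−7, +7]`.» [cite: Samuel1971, §4 Example (1) (p. 289)] -/
theorem Int.samuel_stages (n : ℤ) :
    (n ∉ (motzkinSet 1 : Set ℤ) ↔ -1 ≤ n ∧ n ≤ 1) ∧ (n ∉ (motzkinSet 2 : Set ℤ) ↔ -3 ≤ n ∧ n ≤ 3) ∧
      (n ∉ (motzkinSet 3 : Set ℤ) ↔ -7 ≤ n ∧ n ≤ 7) := by
  refine ⟨?_, ?_, ?_⟩ <;> rw [Int.not_mem_motzkinSet_iff] <;> omega

/-- **Example (1)**: «the smallest algorithm `θ` on `ℤ` is given by `θ(n) =` number of binary digits of `|n|`»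
— Samuel's `θ` is `motzkinRank`, and the number of binary digits is `Nat.size`. [cite: Samuel1971, §4 Example (1) (p. 289)] -/
theorem Int.motzkinRank_eq_size (n : ℤ) : motzkinRank Int.forall_exists_not_mem_motzkinSet n = n.natAbs.size := by
  apply le_antisymm
  · rw [motzkinRank_le_iff, Int.not_mem_motzkinSet_iff]
    exact Nat.lt_size_self _
  · rw [Nat.size_le, ← Int.not_mem_motzkinSet_iff]
    exact not_mem_motzkinSet_motzkinRank _ n

/-! ## §3 Example (2): `k[X]` — the degree is the smallest algorithm -/

section Poly

variable {K : Type*} [Field K]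

/-- §3: «the polynomial ring `k[X]` (`k`: a field) is Euclidean for `φ(P(X)) = 1 + d°(P(X))`» — in form (iii):
division with remainder for `natDegree` (Mathlib's `p / q`, `p % q`). [cite: Samuel1971, §3 (p. 285)] -/
theorem Polynomial.natDegree_euclidean :
    ∀ a b : K[X], b ≠ 0 → ∃ q s : K[X], a = b * q + s ∧ (s = 0 ∨ s.natDegree < b.natDegree) := by
  intro a b hb
  refine ⟨a / b, a % b, (EuclideanDomain.div_add_mod a b).symm, ?_⟩
  by_cases hs : a % b = 0
  · exact Or.inl hs
  · exact Or.inr (natDegree_lt_natDegree hs (EuclideanDomain.mod_lt a hb))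

/-- **Example (2), the stages**: Motzkin's `P₀^{(n)}` in `k[X]` is the set of non-zero polynomials of degree `≥ n`
(equivalently, Samuel's `A_n = {0} ∪ {d° ≤ n − 1}`): a `b` of degree `≥ n+1` keeps the class of `X^n` inside
`P₀^{(n)}`, while for `d°b = n` division by `b` leaves every class with a remainder of degree `< n`.
[cite: Samuel1971, §4 Example (2) (p. 290)] -/
theorem Polynomial.motzkinSet_eq (n : ℕ) : (motzkinSet n : Set K[X]) = {f | f ≠ 0 ∧ n ≤ f.natDegree} := by
  induction n with
  | zero => ext f; simp [motzkinSet_zero]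
  | succ n ih =>
    ext b
    rw [motzkinSet_succ, mem_motzkinDerived, ih]
    simp only [Set.mem_setOf_eq]
    constructor
    · rintro ⟨⟨hb0, hbn⟩, a, ha⟩
      refine ⟨hb0, ?_⟩
      by_contra hlt
      -- `d°b = n`: the class of `a` contains `a % b`, of degree `< n` (or zero)
      have h := ha (-(a / b))
      rw [show a + b * -(a / b) = a % b by
        have := EuclideanDomain.div_add_mod a b; linear_combination -this] at h
      obtain ⟨hr0, hrn⟩ := h
      have := natDegree_lt_natDegree hr0 (EuclideanDomain.mod_lt a hb0)
      omega
    · rintro ⟨hb0, hbn⟩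
      refine ⟨⟨hb0, by omega⟩, X ^ n, fun q ↦ ?_⟩
      by_cases hq : q = 0
      · subst hq
        refine ⟨by simp, ?_⟩
        rw [mul_zero, add_zero, natDegree_X_pow]
      · have hdeg : (X ^ n : K[X]).degree < (b * q).degree :=
          degree_lt_degree (by rw [natDegree_X_pow, natDegree_mul hb0 hq]; omega)
        have hnat : (X ^ n + b * q).natDegree = b.natDegree + q.natDegree := by
          rw [natDegree_add_eq_right_of_degree_lt hdeg, natDegree_mul hb0 hq]
        refine ⟨ne_zero_of_natDegree_gt (n := n) (by rw [hnat]; omega), by rw [hnat]; omega⟩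

/-- Samuel's form of the stages: the complement `A_n` of `P₀^{(n)}` is Mathlib's `degreeLT K n`, the polynomials
of degree `< n` («polynomials with degree `≤ n − 1`»). [cite: Samuel1971, §4 Example (2) (p. 290)] -/
theorem Polynomial.compl_motzkinSet_eq_degreeLT (n : ℕ) :
    (motzkinSet n : Set K[X])ᶜ = ↑(Polynomial.degreeLT K n) := by
  ext f
  rw [Set.mem_compl_iff, Polynomial.motzkinSet_eq, SetLike.mem_coe, Polynomial.mem_degreeLT]
  simp only [Set.mem_setOf_eq, not_and, not_le]
  by_cases hf : f = 0
  · subst hf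
    simp only [ne_eq, not_true_eq_false, IsEmpty.forall_iff, degree_zero, true_iff]
    exact WithBot.bot_lt_coe n
  · simp only [ne_eq, hf, not_false_eq_true, forall_const, degree_eq_natDegree hf, Nat.cast_lt]

/-- «`A_n` is the `n`-dimensional vector space of polynomials with degree `≤ n − 1`.»
[cite: Samuel1971, §4 Example (2) (p. 290)] -/
theorem Polynomial.finrank_degreeLT (n : ℕ) : Module.finrank K (Polynomial.degreeLT K n) = n := by
  rw [LinearEquiv.finrank_eq (Polynomial.degreeLTEquiv K n), Module.finrank_fin_fun]

/-- Motzkin's criterion holds in `k[X]`: `f ∉ P₀^{(d°f + 1)}` (the transfinite construction exhausts `k[X]` at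
stage `ω`). [cite: Samuel1971, §4 Example (2) (p. 290)] -/
theorem Polynomial.forall_exists_not_mem_motzkinSet : ∀ f : K[X], ∃ k : ℕ, f ∉ (motzkinSet k : Set K[X]) :=
  fun f ↦ ⟨f.natDegree + 1, by rw [Polynomial.motzkinSet_eq]; simp⟩

/-- **Example (2)**: «the smallest algorithm `θ` on `k[X]` is the usual algorithm `θ(φ) = 1 + d°(φ)` (`φ ≠ 0`)»
— Samuel's `θ` is `motzkinRank`. [cite: Samuel1971, §4 Example (2) (p. 290)] -/
theorem Polynomial.motzkinRank_eq {f : K[X]} (hf : f ≠ 0) :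
    motzkinRank Polynomial.forall_exists_not_mem_motzkinSet f = f.natDegree + 1 := by
  apply le_antisymm
  · rw [motzkinRank_le_iff, Polynomial.motzkinSet_eq]
    simp
  · by_contra hlt
    have h := not_mem_motzkinSet_motzkinRank Polynomial.forall_exists_not_mem_motzkinSet f
    rw [Polynomial.motzkinSet_eq] at h
    exact h ⟨hf, by omega⟩

/-- Motzkin's minimal Euclidean function of `k[X]` is the degree: `|f|_M = d°f` (and `|0|_M = 0 = natDegree 0`).
[cite: Samuel1971, §4 Example (2) (p. 290)] -/
theorem Polynomial.motzkinNorm_eq_natDegree (f : K[X]) :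
    motzkinNorm Polynomial.forall_exists_not_mem_motzkinSet f = f.natDegree := by
  unfold motzkinNorm
  by_cases hf : f = 0
  · subst hf
    rw [(motzkinRank_eq_zero_iff _).mpr rfl, natDegree_zero]
  · rw [Polynomial.motzkinRank_eq hf]; rfl

/-- The degree is the SMALLEST algorithm on `k[X]`: every `ℕ`-valued Euclidean function `φ` (form (iii))
satisfies `d°f ≤ φ(f)` for `f ≠ 0`. [cite: Samuel1971, §4 Example (2) (p. 290)] -/
theorem Polynomial.natDegree_le_of_euclideanFunction {φ : K[X] → ℕ}
    (hφ : ∀ a b : K[X], b ≠ 0 → ∃ q s : K[X], a = b * q + s ∧ (s = 0 ∨ φ s < φ b)) {f : K[X]} (hf : f ≠ 0) :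
    f.natDegree ≤ φ f := by
  rw [← Polynomial.motzkinNorm_eq_natDegree f]
  exact motzkinNorm_le _ hφ hf

/-- «Since `A* = k*` we have `A'₁ = A₁ = k`»: the first stage consists of `0` and the non-zero constants.
[cite: Samuel1971, §4 Example (2) (p. 290)] -/
theorem Polynomial.not_mem_motzkinSet_one_iff (f : K[X]) : f ∉ (motzkinSet 1 : Set K[X]) ↔ ∃ c : K, f = C c := by
  rw [Polynomial.motzkinSet_eq]
  simp only [Set.mem_setOf_eq, not_and, not_le, Nat.lt_one_iff]
  constructor
  · intro h
    by_cases hf : f = 0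
    · exact ⟨0, by rw [hf, map_zero]⟩
    · exact ⟨f.coeff 0, eq_C_of_natDegree_eq_zero (h hf)⟩
  · rintro ⟨c, rfl⟩ _
    exact natDegree_C c

end Poly

end Literature.Algebra.EuclideanDomain
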